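import Literature.MathematicalPhysics.QuantumFieldTheory.Balaban1983to89.B15Sect1Statements
import Literature.MathematicalPhysics.QuantumFieldTheory.Balaban1983to89.B15Norm1102Multi

/-!
# `Balaban1983to89.B15Norm1102Object` — [Balaban1989LargeFieldI] (1.102) p. 201 for the OBJECT 𝐑′ of (1.100)
# (`B15Sect1Statements.rPrime1100` / `Normalization1102`), PROVED in the fibre model of the integral operations

statement-level skeleton of published theorems with citation tags; proofs where landed; nothing here is a claim about
the Yang–Mills mass gap.

CITATION HEADER (lean-in-tree rule 2026-08-18).  T. Bałaban, *Large field renormalization. I. The basic step of the 𝐑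
operation*, Commun. Math. Phys. **122**, 175–202 (1989), doi:10.1007/BF01257412, bib `Balaban1989LargeFieldI` (cell
paper B15; PDF held `paper:balaban1989-cmp122-large-field-i`, journal page = PDF page + 174; pp. 176, 193–194, 200–202
READ AS IMAGES on the x2 renders `run/shared/lean/pub/pub-balaban/b2b-balaban-ref1/pages/1989-cmp122-large-field-I/
…-p002,p019,p020,p026,p027,p028-x2.png`).  The paper is a manuscript under adjudication by the audit cell `pub-balaban`;
NOTHING printed in it is asserted here as a fact.  WHAT IS REPRODUCED: SKELETON rows `B15.Eq1.102` / `B15.Obj1.100`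
(the lead's NEED row, INTERFACES §1.1 NE1′ PULL P1) / `B15.Eq1.100` / `B15.Eq1.99`, unit `lit-balaban-r12` gen 7
(reader/typer and fold owner of block B15, Phase 2 in own block), HOME `run/shared/lean/pub/lit-balaban/`
(`lit-balaban-r12/ROWS-B15.md`).  Tree vocabulary used BY NAME, nothing restated: the object `B15Sect1Statements.
{Insert1100 (num/den/ratio), Component1100 (op/bareOp), Family1100 (prodOp/bareProdOp), RPrimeData (curly/bareCurly),
rPrime1100, bare199, Equiv199, Normalization1102, normalization1102_of_equiv199}` (r12 gen 2, p240418) and the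
mechanism `B15.BasicStep.{fibreIntegral, normTerm, integral_normTerm_eq, lmarginal_mul_of_indepOf, lmarginal_of_indepOf,
indepOf_lmarginal, lintegral_lmarginal_eq, lmarginal_ofReal_le, fieldMeasure_eq_pi}` (b01), `B15Norm1102Multi.
indepOf_lmarginal` (r12 gen 7).

THE PRINTED SENTENCES (verbatim).  (1.100)/(1.102) p. 201 [PDF 27]: *"(ℝ′ρ_k)(V_k) = Σ_{Z_k}( Σ 𝕋″_k(Z_k) ){ Σ_{n≥0}
Σ_{{X_1,…,X_n}} χ_k(Ω_k^{∼4}) Π_{i=1}^{n}[ (1/N_i) Σ χ_{k,Λ_i} · δ_{G_i}(V′_k)χ(Λ_i)exp[…] / ∫dV′⌈_{Λ_i}δ_{G_i}(V′)χ(Λ_i)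
exp[…] · ∫dV_h⌈…𝕋_h(Z_{i,h})∫dV′⌈_{𝔹_i}δ_{T_i}(V′)χ′_i ] exp A″_k }"*; *"The above operation has the fundamental
normalization property ∫dV_k(ℝ′ρ_k)(V_k) = ∫dV_kρ_k(V_k). (1.102)"*;  p. 201: *"we separate the summation over the
admissible Z_k, n, X_1,…,X_n, from the remaining summations, which are factorized in those domains. … The integrations
in (1.99) are also factorized in those components."*;  p. 200 [PDF 26]: *"the integral operations have many forms,
varying from the old 𝕋-operations to the integrals as in (1.76) … These operations are denoted by 𝕋″_k"*;  p. 194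
[PDF 20]: *"The next operation is an integration of this term with respect to the field variables V_k over the domain
Λ. We obtain a new expression, which we consider as a function of all field variables V_k, but independent of V_k⌈_Λ."*;
p. 193 [PDF 19]: *"the equivalence means that both sides have equal integrals over the space of fields V_k"*;  p. 176
[PDF 2]: *"We will prove that the densities are positive, and the inegration* [sic] *domains in the integrals above are
nonempty, hence the denominators are positive"*.

THE FIBRE MODEL (the one modelling hypothesis of this module, stated as explicit hypotheses of the theorems, never as a
`def … : Prop`).  In `B15Sect1Statements` the old localized integral operations `∫dV_h⌈…∫dV′⌈_{𝔹_i}δ_{T_i}(V′)χ′_i[·]`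
of a component and the operations `𝕋″_k(Z_k)` are abstract operators `Density → Density` (conventions (b)/(d) there).
Here they are taken IN FIBRE FORM over the tree's carrier: `oldOp_l ρ = ∫dV_k⌈_{Λ_l}(u_l · ρ)` — the `V_k⌈_{Λ_l}`-
integration of p. 194 ((1.76); the auxiliary variables `V_h`, `V′` being integrated inside, convention (b)) against a
measurable weight `u_l ∈ [0, Cu]` — and `𝕋″ ρ = ∫dV_k⌈_{B}(w · ρ)` with any domain `B` and a measurable weight
`w ∈ [0, Cw]`.  The printed provisos enter as: `χ_k(Ω_k^{∼4}), χ_{k,Λ_i} ∈ [0,1]` measurable; inserts measurable in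
`[0, Cn]` with denominators `≥ c > 0` (p. 176); `exp A″_k` measurable, nonnegative, bounded; weights `1/N_i ≥ 0`;
LOCALIZATION (p. 201 *"localized in X_i"*, (1.75) *"a restriction on V_k⌈_{Z∩Λᶜ} only"*): `χ_{k,Λ_i}` independent of
`V_k⌈_{Λ_i}`, and `χ_{k,Λ_i}`, `u_i`, `χ_k(Ω_k^{∼4})`, `w` independent of the fresh variables `V_k⌈_{Λ_{i′}}` of the
components `i′` standing to the right of `i` in the printed product.  (Disjointness of the `Λ_i` is not even needed in
the composition reading (d): the nesting fixes an order of integration.)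

WHAT IS TYPED AND PROVED (0 `sorry`, no `def`, no new `Prop`; all `theorem`s kernel-checked).
* Part 1 — API of `B15.BasicStep.fibreIntegral` (`∫dV⌈_Λ` of a real density): `fibreIntegral_nonneg`, `fibreIntegral_le`,
  `measurable_fibreIntegral`, `fibreIntegral_update_self` (independent of `V⌈_Λ`, p. 194), `fibreIntegral_update_of_indep`,
  `fibreIntegral_of_indep` (a density independent of `V⌈_Λ` is its own fibre integral), `fibreIntegral_mul_of_indep`
  (pull-out), `integral_fibreIntegral` (`∫dV_k ∫dV⌈_Λ f = ∫dV_k f`, p. 193), `integral_mul_fibreIntegral`.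
* Part 2 — `prodOp_mk_zero/succ`, `bareProdOp_mk_zero/succ` (unfolding the composition `Π_{i=1}^{n}`); `op_regular`,
  `bareOp_regular`, `prodOp_regular`, `bareProdOp_regular` (measurable / nonnegative / bounded through the brackets).
* Part 3 — `integral_mul_prodOp_eq`: **for an `n`-component family, `∫dV_k g·Π_i[bracket_i](E) = ∫dV_k g·Π_i[bare
  bracket_i](E)`** for every admissible outer factor `g` — the inserts integrate to one, one component at a time along
  the composition (first quotient against the rest by `integral_normTerm_eq`, the rest being independent of `V_k⌈_{Λ_1}`
  because the old operation integrated those variables; undo/redo the old fibre integration under `∫dV_k`; induction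
  with outer factor `g·χ_{k,Λ_1}·u_1`).
* Part 4 — `curly_regular`, `bareCurly_regular`; `integral_mul_curly_eq` (the curly bracket); **`integral_rPrime1100_eq_
  bare199`: `∫dV_k (𝐑′ρ_k) = ∫dV_k (1.99)`**; **`normalization1102_of_fibreModel`: `Equiv199 D ρ_k` + the fibre model
  ⇒ `Normalization1102 D ρ_k`** — (1.102) for the object, by `normalization1102_of_equiv199`.
Relation to the siblings: `B15Sect1Statements.integral_rPrime1100_single` is the one-region/one-family/one-component
instance with the old operation abstract (its output assumed independent of `V_k⌈_{Λ}`); `B15Norm1102Multi` proves the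
FACTORIZED (product-of-densities) form for `n` components over pairwise-disjoint domains; this module proves the
COMPOSITION form (d) of `B15Sect1Statements` for the full object, at the price of the fibre form of the operations.
NOT CLAIMED: that Bałaban's actual operations satisfy the fibre model beyond what pp. 194/200/201 print (the multi-scale
`𝕋`-operations integrate auxiliary fields of all scales — inside the operators here); positivity/analyticity of the
densities ([II]); the geometry of admissible families.
-/

open scoped BigOperators ENNReal
open _root_.MeasureTheory Function Finset

namespace Literature.MathematicalPhysics.QuantumFieldTheory.Balaban1983to89.B15Norm1102Object

open B15.BasicStep B15Sect1Statements B15Norm1102Multi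

variable {P : Params} {k : ℕ} {G : Type*} [GaugeGroup G] [MeasurableSpace G] [HaarData G] [DecidableEq (PBond P k)]

/-! ## Part 1. The fibre integral `∫dV⌈_Λ` of a real density (`B15.BasicStep.fibreIntegral`): the API used below -/

section FibreAPI

omit [GaugeGroup G] [HaarData G] [DecidableEq (PBond P k)] in
/-- A bounded, nonnegative, measurable density is integrable over the (probability) field measure. [folklore] -/
private theorem integrable_of_bdd [GaugeGroup G] [HaarData G] {f : Density P k G} (hm : Measurable f)
    (h0 : ∀ V, 0 ≤ f V) {C : ℝ} (hC : ∀ V, f V ≤ C) : Integrable f (fieldMeasure P k G) :=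
  (integrable_const C).mono' hm.aestronglyMeasurable
    (Filter.Eventually.of_forall (fun V => by rw [Real.norm_eq_abs, abs_of_nonneg (h0 V)]; exact hC V))

/-- `∫dV⌈_Λ f ≥ 0`. [cite: Balaban1989LargeFieldI, (0.3) p.176] -/
theorem fibreIntegral_nonneg (s : Finset (PBond P k)) (f : Density P k G) (V : GaugeField P k G) :
    0 ≤ fibreIntegral s f V :=
  ENNReal.toReal_nonneg

/-- `f ≤ C` with `C ≥ 0` gives `∫dV⌈_Λ f ≤ C` (normalized Haar fibres, p. 176). [cite: Balaban1989LargeFieldI, (0.3) p.176] -/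
theorem fibreIntegral_le (s : Finset (PBond P k)) {f : Density P k G} {C : ℝ} (hC : ∀ V, f V ≤ C) (hC0 : 0 ≤ C)
    (V : GaugeField P k G) : fibreIntegral s f V ≤ C :=
  ENNReal.toReal_le_of_le_ofReal hC0 (lmarginal_ofReal_le s hC V)

/-- `∫dV⌈_Λ f` is a measurable function of the field for measurable `f`. [cite: Balaban1989LargeFieldI, (0.3) p.176] -/
theorem measurable_fibreIntegral (s : Finset (PBond P k)) {f : Density P k G} (hf : Measurable f) :
    Measurable (fibreIntegral s f) :=
  ((ofReal_comp_measurable hf).lmarginal (fun _ : PBond P k => (HaarData.haar : Measure G))).ennreal_toReal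

/-- `∫dV⌈_Λ f` does not depend on the variables `V⌈_Λ` (p. 194: *"independent of V_k⌈_Λ"*). [cite: Balaban1989LargeFieldI, p.194] -/
theorem fibreIntegral_update_self (s : Finset (PBond P k)) (f : Density P k G) (V : GaugeField P k G)
    (y : ↥s → G) : fibreIntegral s f (updateFinset V s y) = fibreIntegral s f V := by
  unfold fibreIntegral
  exact congrArg ENNReal.toReal
    (indepOf_lmarginal (fun _ : PBond P k => (HaarData.haar : Measure G)) s _ V y)

/-- If `f` does not depend on the variables `V⌈_t`, neither does `∫dV⌈_Λ f` (any `Λ`) — p. 194: *"The two integrals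
above are over the disjoint regions of integrations, hence we can consider them independently."* [cite: Balaban1989LargeFieldI, p.194] -/
theorem fibreIntegral_update_of_indep (s t : Finset (PBond P k)) {f : Density P k G}
    (hf : ∀ (V : GaugeField P k G) (y : ↥t → G), f (updateFinset V t y) = f V) (V : GaugeField P k G)
    (y : ↥t → G) : fibreIntegral s f (updateFinset V t y) = fibreIntegral s f V := by
  have hf' : IndepOf t (fun U : GaugeField P k G => ENNReal.ofReal (f U)) := by
    intro x z
    show ENNReal.ofReal (f (updateFinset x t z)) = ENNReal.ofReal (f x)
    rw [hf x z]
  unfold fibreIntegral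
  exact congrArg ENNReal.toReal
    (indepOf_lmarginal (μ := fun _ : PBond P k => (HaarData.haar : Measure G)) (s := s) hf' V y)

/-- A nonnegative density independent of `V⌈_Λ` is its own fibre integral (normalized Haar fibres; p. 194).
[cite: Balaban1989LargeFieldI, p.194] -/
theorem fibreIntegral_of_indep (s : Finset (PBond P k)) {f : Density P k G}
    (hf : ∀ (V : GaugeField P k G) (y : ↥s → G), f (updateFinset V s y) = f V) (hf0 : ∀ V, 0 ≤ f V)
    (V : GaugeField P k G) : fibreIntegral s f V = f V := by
  have hf' : IndepOf s (fun U : GaugeField P k G => ENNReal.ofReal (f U)) := by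
    intro x z
    show ENNReal.ofReal (f (updateFinset x s z)) = ENNReal.ofReal (f x)
    rw [hf x z]
  unfold fibreIntegral
  have key := lmarginal_of_indepOf (μ := fun _ : PBond P k => (HaarData.haar : Measure G)) s hf'
  exact (congrArg (fun φ : GaugeField P k G → ℝ≥0∞ => (φ V).toReal) key).trans (ENNReal.toReal_ofReal (hf0 V))

/-- A nonnegative factor independent of `V⌈_Λ` pulls out of `∫dV⌈_Λ` (p. 194). [cite: Balaban1989LargeFieldI, p.194] -/
theorem fibreIntegral_mul_of_indep (s : Finset (PBond P k)) {h f : Density P k G}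
    (hh : ∀ (V : GaugeField P k G) (y : ↥s → G), h (updateFinset V s y) = h V) (hh0 : ∀ V, 0 ≤ h V)
    (hf : Measurable f) (V : GaugeField P k G) :
    fibreIntegral s (fun U => h U * f U) V = h V * fibreIntegral s f V := by
  have hh' : IndepOf s (fun U : PBond P k → G => ENNReal.ofReal (h U)) := by
    intro x z
    show ENNReal.ofReal (h (updateFinset x s z)) = ENNReal.ofReal (h x)
    rw [hh x z]
  have hsplit : (fun U : PBond P k → G => ENNReal.ofReal (h U * f U))
      = (fun U => ENNReal.ofReal (h U)) * (fun U => ENNReal.ofReal (f U)) := by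
    funext U
    simp only [Pi.mul_apply, ENNReal.ofReal_mul (hh0 U)]
  unfold fibreIntegral
  have key : (∫⋯∫⁻_s, (fun U : PBond P k → G => ENNReal.ofReal (h U * f U))
      ∂(fun _ : PBond P k => (HaarData.haar : Measure G)))
      = (fun U : PBond P k → G => ENNReal.ofReal (h U)) * ∫⋯∫⁻_s, (fun U : PBond P k → G => ENNReal.ofReal (f U))
          ∂(fun _ : PBond P k => (HaarData.haar : Measure G)) :=
    (congrArg (fun φ => ∫⋯∫⁻_s, φ ∂(fun _ : PBond P k => (HaarData.haar : Measure G))) hsplit).trans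
      (lmarginal_mul_of_indepOf s hh' (ofReal_comp_measurable hf))
  have key' := congrArg (fun φ : (PBond P k → G) → ℝ≥0∞ => (φ V).toReal) key
  refine key'.trans ?_
  show (ENNReal.ofReal (h V) * (∫⋯∫⁻_s, (fun U : PBond P k → G => ENNReal.ofReal (f U))
      ∂(fun _ : PBond P k => (HaarData.haar : Measure G))) V).toReal
    = h V * ((∫⋯∫⁻_s, (fun U : PBond P k → G => ENNReal.ofReal (f U))
      ∂(fun _ : PBond P k => (HaarData.haar : Measure G))) V).toReal
  rw [ENNReal.toReal_mul, ENNReal.toReal_ofReal (hh0 V)]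

/-- The Λ-integration preserves total integrals (p. 193 l.−9: *"the equivalence means that both sides have equal
integrals over the space of fields V_k"*): `∫dV_k ∫dV⌈_Λ f = ∫dV_k f` for bounded nonnegative measurable `f`.
[cite: Balaban1989LargeFieldI, p.193] -/
theorem integral_fibreIntegral (s : Finset (PBond P k)) {f : Density P k G} (hf : Measurable f)
    (hf0 : ∀ V, 0 ≤ f V) {C : ℝ} (hC : ∀ V, f V ≤ C) :
    ∫ V, fibreIntegral s f V ∂(fieldMeasure P k G) = ∫ V, f V ∂(fieldMeasure P k G) := by
  set μH : PBond P k → Measure G := fun _ => (HaarData.haar : Measure G) with hμH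
  have hFm : Measurable (fun U : GaugeField P k G => ENNReal.ofReal (f U)) := ofReal_comp_measurable hf
  have h1 : ∫ V, fibreIntegral s f V ∂(fieldMeasure P k G)
      = (∫⁻ V, (∫⋯∫⁻_s, (fun U => ENNReal.ofReal (f U)) ∂μH) V ∂(fieldMeasure P k G)).toReal := by
    simp only [fibreIntegral]
    rw [← hμH]
    exact integral_toReal (hFm.lmarginal μH).aemeasurable
      (Filter.Eventually.of_forall (fun V => lt_of_le_of_lt (lmarginal_ofReal_le s hC V) ENNReal.ofReal_lt_top))
  have h2 : ∫ V, f V ∂(fieldMeasure P k G) = (∫⁻ V, ENNReal.ofReal (f V) ∂(fieldMeasure P k G)).toReal := by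
    rw [← integral_toReal hFm.aemeasurable (Filter.Eventually.of_forall (fun V => ENNReal.ofReal_lt_top))]
    exact integral_congr_ae (Filter.Eventually.of_forall (fun V => (ENNReal.toReal_ofReal (hf0 V)).symm))
  rw [h1, h2, fieldMeasure_eq_pi]
  exact congrArg ENNReal.toReal (lintegral_lmarginal_eq μH s hFm)

/-- Hence a factor independent of `V⌈_Λ` sees `∫dV⌈_Λ f` as `f` under `∫dV_k`:
`∫dV_k h·∫dV⌈_Λ f = ∫dV_k h·f`. [cite: Balaban1989LargeFieldI, p.194] -/
theorem integral_mul_fibreIntegral (s : Finset (PBond P k)) {h f : Density P k G} (hhm : Measurable h)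
    (hh0 : ∀ V, 0 ≤ h V) {Ch : ℝ} (hhC : ∀ V, h V ≤ Ch)
    (hh : ∀ (V : GaugeField P k G) (y : ↥s → G), h (updateFinset V s y) = h V)
    (hf : Measurable f) (hf0 : ∀ V, 0 ≤ f V) {Cf : ℝ} (hfC : ∀ V, f V ≤ Cf) :
    ∫ V, h V * fibreIntegral s f V ∂(fieldMeasure P k G) = ∫ V, h V * f V ∂(fieldMeasure P k G) := by
  have hrw : ∀ V, h V * fibreIntegral s f V = fibreIntegral s (fun U => h U * f U) V :=
    fun V => (fibreIntegral_mul_of_indep s hh hh0 hf V).symm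
  rw [integral_congr_ae (Filter.Eventually.of_forall hrw)]
  have hCh : 0 ≤ Ch := le_trans (hh0 1) (hhC 1)
  exact integral_fibreIntegral s (hhm.mul hf) (fun V => mul_nonneg (hh0 V) (hf0 V))
    (C := Ch * Cf) (fun V => mul_le_mul (hhC V) (hfC V) (hf0 V) hCh)

end FibreAPI

/-! ## Part 2. The product `Π_{i=1}^{n}[ … ]` of (1.100) (convention (d) of `B15Sect1Statements`: composition of the
component operators in the printed order): unfolding, and regularity (measurable, nonnegative, bounded) of the composed
densities in the FIBRE MODEL of the old localized integral operations -/

section Product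

/-- `n = 0`: the product is the identity. [cite: Balaban1989LargeFieldI, (1.100) p.201] -/
theorem prodOp_mk_zero (chiK4 : Density P k G) (comp : Fin 0 → Component1100 P k G) :
    (Family1100.mk 0 chiK4 comp).prodOp = id := rfl

omit [DecidableEq (PBond P k)] in
/-- `n = 0`, no inserts: the identity. [cite: Balaban1989LargeFieldI, (1.99) p.201] -/
theorem bareProdOp_mk_zero (chiK4 : Density P k G) (comp : Fin 0 → Component1100 P k G) :
    (Family1100.mk 0 chiK4 comp).bareProdOp = id := rfl

/-- `Π_{i=1}^{n+1} = [bracket_1] ∘ Π_{i=2}^{n+1}`. [cite: Balaban1989LargeFieldI, (1.100) p.201] -/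
theorem prodOp_mk_succ {n : ℕ} (chiK4 : Density P k G) (comp : Fin (n + 1) → Component1100 P k G) :
    (Family1100.mk (n + 1) chiK4 comp).prodOp
      = (comp 0).op ∘ (Family1100.mk n chiK4 (fun i => comp i.succ)).prodOp := by
  simp only [Family1100.prodOp, List.ofFn_succ, List.foldr_cons]

omit [DecidableEq (PBond P k)] in
/-- The same for the product without inserts. [cite: Balaban1989LargeFieldI, (1.99) p.201] -/
theorem bareProdOp_mk_succ {n : ℕ} (chiK4 : Density P k G) (comp : Fin (n + 1) → Component1100 P k G) :
    (Family1100.mk (n + 1) chiK4 comp).bareProdOp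
      = (comp 0).bareOp ∘ (Family1100.mk n chiK4 (fun i => comp i.succ)).bareProdOp := by
  simp only [Family1100.bareProdOp, List.ofFn_succ, List.foldr_cons]

variable {Cn c Cu : ℝ}

/-- ONE bracket of (1.100) applied to a measurable, nonnegative, bounded density is again measurable, nonnegative and
bounded — in the FIBRE MODEL of its old localized integral operation (`oldOp l ρ = ∫dV⌈_{Λ_l}(u_l·ρ)` with a bounded
nonnegative measurable weight `u_l`; p. 194/(1.76)), with `χ_{k,Λ} ∈ [0,1]`, bounded nonnegative measurable inserts and
denominators bounded below by `c > 0` (p. 176: *"hence the denominators are positive"*).  The hypothesis bundle `hloc l`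
lists, for the localized datum `l`: `χ_{k,Λ_l}` measurable, in `[0,1]`; the insert `num_l` measurable, in `[0,Cn]`;
`c ≤ den_l`; the weight `u_l` measurable, in `[0,Cu]`; the fibre form of `oldOp l`; `χ_{k,Λ_l}` independent of
`V_k⌈_{Λ_l}` ((1.75): a restriction on `V_k⌈_{Z∩Λᶜ}` only). [cite: Balaban1989LargeFieldI, (1.100) p.201] -/
theorem op_regular (C : Component1100 P k G) (u : C.Loc → Density P k G) (hw : 0 ≤ C.weight) (hc : 0 < c)
    (hloc : ∀ l, Measurable (C.chiKΛ l) ∧ (∀ V, 0 ≤ C.chiKΛ l V ∧ C.chiKΛ l V ≤ 1) ∧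
      Measurable (C.ins l).num ∧ (∀ V, 0 ≤ (C.ins l).num V ∧ (C.ins l).num V ≤ Cn) ∧
      (∀ V, c ≤ (C.ins l).den V) ∧ Measurable (u l) ∧ (∀ V, 0 ≤ u l V ∧ u l V ≤ Cu) ∧
      (∀ ρ, C.oldOp l ρ = fibreIntegral (C.ins l).lam (fun U => u l U * ρ U)) ∧
      (∀ (V : GaugeField P k G) (y : ↥(C.ins l).lam → G), C.chiKΛ l (updateFinset V (C.ins l).lam y) = C.chiKΛ l V))
    {σ : Density P k G} (hσm : Measurable σ) (hσ0 : ∀ V, 0 ≤ σ V) {B : ℝ} (hσB : ∀ V, σ V ≤ B) :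
    Measurable (C.op σ) ∧ (∀ V, 0 ≤ C.op σ V) ∧ (∀ V, C.op σ V ≤ C.weight * ∑ _l : C.Loc, Cn / c * (Cu * B)) := by
  have hB0 : 0 ≤ B := le_trans (hσ0 1) (hσB 1)
  have hold_m : ∀ l, Measurable (C.oldOp l σ) := fun l => by
    rw [(hloc l).2.2.2.2.2.2.2.1 σ]; exact measurable_fibreIntegral _ ((hloc l).2.2.2.2.2.1.mul hσm)
  have hold0 : ∀ l V, 0 ≤ C.oldOp l σ V := fun l V => by
    rw [(hloc l).2.2.2.2.2.2.2.1 σ]; exact fibreIntegral_nonneg _ _ V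
  have holdB : ∀ l V, C.oldOp l σ V ≤ Cu * B := fun l V => by
    have hub := (hloc l).2.2.2.2.2.2.1
    rw [(hloc l).2.2.2.2.2.2.2.1 σ]
    exact fibreIntegral_le _ (fun U => mul_le_mul (hub U).2 (hσB U) (hσ0 U) ((hub U).1.trans (hub U).2))
      (mul_nonneg ((hub V).1.trans (hub V).2) hB0) V
  have hr_m : ∀ l, Measurable (C.ins l).ratio := fun l =>
    (hloc l).2.2.1.div (measurable_fibreIntegral _ (hloc l).2.2.1)
  have hr0 : ∀ l V, 0 ≤ (C.ins l).ratio V := fun l V =>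
    div_nonneg ((hloc l).2.2.2.1 V).1 (hc.le.trans ((hloc l).2.2.2.2.1 V))
  have hrB : ∀ l V, (C.ins l).ratio V ≤ Cn / c := fun l V =>
    div_le_div₀ (((hloc l).2.2.2.1 V).1.trans ((hloc l).2.2.2.1 V).2) ((hloc l).2.2.2.1 V).2 hc
      ((hloc l).2.2.2.2.1 V)
  refine ⟨?_, ?_, ?_⟩
  · show Measurable (fun V => C.weight * ∑ l, C.chiKΛ l V * (C.ins l).ratio V * C.oldOp l σ V)
    exact (Finset.measurable_sum _ (fun l _ => (((hloc l).1.mul (hr_m l)).mul (hold_m l)))).const_mul _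
  · intro V
    show 0 ≤ C.weight * ∑ l, C.chiKΛ l V * (C.ins l).ratio V * C.oldOp l σ V
    exact mul_nonneg hw (Finset.sum_nonneg (fun l _ =>
      mul_nonneg (mul_nonneg ((hloc l).2.1 V).1 (hr0 l V)) (hold0 l V)))
  · intro V
    show C.weight * ∑ l, C.chiKΛ l V * (C.ins l).ratio V * C.oldOp l σ V ≤ C.weight * ∑ _l : C.Loc, Cn / c * (Cu * B)
    refine mul_le_mul_of_nonneg_left (Finset.sum_le_sum (fun l _ => ?_)) hw
    have hCn0 : 0 ≤ Cn / c := div_nonneg (((hloc l).2.2.2.1 V).1.trans ((hloc l).2.2.2.1 V).2) hc.le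
    calc C.chiKΛ l V * (C.ins l).ratio V * C.oldOp l σ V ≤ 1 * (Cn / c) * (Cu * B) :=
          mul_le_mul (mul_le_mul ((hloc l).2.1 V).2 (hrB l V) (hr0 l V) zero_le_one) (holdB l V) (hold0 l V)
            (mul_nonneg zero_le_one hCn0)
      _ = Cn / c * (Cu * B) := by ring

omit [DecidableEq (PBond P k)] in
/-- The same for the bracket WITHOUT the insert quotient ((1.99) side). [cite: Balaban1989LargeFieldI, (1.99) p.201] -/
theorem bareOp_regular [DecidableEq (PBond P k)] (C : Component1100 P k G) (u : C.Loc → Density P k G)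
    (hw : 0 ≤ C.weight)
    (hloc : ∀ l, Measurable (C.chiKΛ l) ∧ (∀ V, 0 ≤ C.chiKΛ l V ∧ C.chiKΛ l V ≤ 1) ∧
      Measurable (u l) ∧ (∀ V, 0 ≤ u l V ∧ u l V ≤ Cu) ∧
      (∀ ρ, C.oldOp l ρ = fibreIntegral (C.ins l).lam (fun U => u l U * ρ U)))
    {σ : Density P k G} (hσm : Measurable σ) (hσ0 : ∀ V, 0 ≤ σ V) {B : ℝ} (hσB : ∀ V, σ V ≤ B) :
    Measurable (C.bareOp σ) ∧ (∀ V, 0 ≤ C.bareOp σ V) ∧ (∀ V, C.bareOp σ V ≤ C.weight * ∑ _l : C.Loc, Cu * B) := by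
  have hB0 : 0 ≤ B := le_trans (hσ0 1) (hσB 1)
  have hold_m : ∀ l, Measurable (C.oldOp l σ) := fun l => by
    rw [(hloc l).2.2.2.2 σ]; exact measurable_fibreIntegral _ ((hloc l).2.2.1.mul hσm)
  have hold0 : ∀ l V, 0 ≤ C.oldOp l σ V := fun l V => by
    rw [(hloc l).2.2.2.2 σ]; exact fibreIntegral_nonneg _ _ V
  have holdB : ∀ l V, C.oldOp l σ V ≤ Cu * B := fun l V => by
    have hub := (hloc l).2.2.2.1
    rw [(hloc l).2.2.2.2 σ]
    exact fibreIntegral_le _ (fun U => mul_le_mul (hub U).2 (hσB U) (hσ0 U) ((hub U).1.trans (hub U).2))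
      (mul_nonneg ((hub V).1.trans (hub V).2) hB0) V
  refine ⟨?_, ?_, ?_⟩
  · show Measurable (fun V => C.weight * ∑ l, C.chiKΛ l V * C.oldOp l σ V)
    exact (Finset.measurable_sum _ (fun l _ => ((hloc l).1.mul (hold_m l)))).const_mul _
  · intro V
    show 0 ≤ C.weight * ∑ l, C.chiKΛ l V * C.oldOp l σ V
    exact mul_nonneg hw (Finset.sum_nonneg (fun l _ => mul_nonneg ((hloc l).2.1 V).1 (hold0 l V)))
  · intro V
    show C.weight * ∑ l, C.chiKΛ l V * C.oldOp l σ V ≤ C.weight * ∑ _l : C.Loc, Cu * B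
    refine mul_le_mul_of_nonneg_left (Finset.sum_le_sum (fun l _ => ?_)) hw
    calc C.chiKΛ l V * C.oldOp l σ V ≤ 1 * (Cu * B) :=
          mul_le_mul ((hloc l).2.1 V).2 (holdB l V) (hold0 l V) zero_le_one
      _ = Cu * B := by ring

/-- Regularity of `Π_{i=1}^{n}[ … ](E)` in the fibre model: measurable, nonnegative, bounded (induction on the
components with `op_regular`). [cite: Balaban1989LargeFieldI, (1.100) p.201] -/
theorem prodOp_regular (hc : 0 < c) : ∀ (n : ℕ) (comp : Fin n → Component1100 P k G)
    (u : (i : Fin n) → (comp i).Loc → Density P k G) (chiK4 E : Density P k G) (CE : ℝ),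
    (∀ i, 0 ≤ (comp i).weight) →
    (∀ i l, Measurable ((comp i).chiKΛ l) ∧ (∀ V, 0 ≤ (comp i).chiKΛ l V ∧ (comp i).chiKΛ l V ≤ 1) ∧
      Measurable ((comp i).ins l).num ∧ (∀ V, 0 ≤ ((comp i).ins l).num V ∧ ((comp i).ins l).num V ≤ Cn) ∧
      (∀ V, c ≤ ((comp i).ins l).den V) ∧ Measurable (u i l) ∧ (∀ V, 0 ≤ u i l V ∧ u i l V ≤ Cu) ∧
      (∀ ρ, (comp i).oldOp l ρ = fibreIntegral ((comp i).ins l).lam (fun U => u i l U * ρ U)) ∧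
      (∀ (V : GaugeField P k G) (y : ↥((comp i).ins l).lam → G),
        (comp i).chiKΛ l (updateFinset V ((comp i).ins l).lam y) = (comp i).chiKΛ l V)) →
    Measurable E → (∀ V, 0 ≤ E V) → (∀ V, E V ≤ CE) →
    Measurable ((Family1100.mk n chiK4 comp).prodOp E) ∧ (∀ V, 0 ≤ (Family1100.mk n chiK4 comp).prodOp E V) ∧
      ∃ B : ℝ, ∀ V, (Family1100.mk n chiK4 comp).prodOp E V ≤ B := by
  intro n
  induction n with
  | zero =>
    intro comp u chiK4 E CE _ _ hEm hE0 hEC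
    exact ⟨hEm, hE0, CE, hEC⟩
  | succ n IH =>
    intro comp u chiK4 E CE hw hloc hEm hE0 hEC
    obtain ⟨hm, h0, B, hB⟩ := IH (fun i => comp i.succ) (fun i => u i.succ) chiK4 E CE (fun i => hw i.succ)
      (fun i l => hloc i.succ l) hEm hE0 hEC
    rw [prodOp_mk_succ]
    obtain ⟨hm', h0', hB'⟩ := op_regular (comp 0) (u 0) (hw 0) hc (hloc 0) hm h0 hB
    exact ⟨hm', h0', _, hB'⟩

omit [DecidableEq (PBond P k)] in
/-- Regularity of the insert-free product ((1.99) side). [cite: Balaban1989LargeFieldI, (1.99) p.201] -/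
theorem bareProdOp_regular [DecidableEq (PBond P k)] : ∀ (n : ℕ) (comp : Fin n → Component1100 P k G)
    (u : (i : Fin n) → (comp i).Loc → Density P k G) (chiK4 E : Density P k G) (CE : ℝ),
    (∀ i, 0 ≤ (comp i).weight) →
    (∀ i l, Measurable ((comp i).chiKΛ l) ∧ (∀ V, 0 ≤ (comp i).chiKΛ l V ∧ (comp i).chiKΛ l V ≤ 1) ∧
      Measurable (u i l) ∧ (∀ V, 0 ≤ u i l V ∧ u i l V ≤ Cu) ∧
      (∀ ρ, (comp i).oldOp l ρ = fibreIntegral ((comp i).ins l).lam (fun U => u i l U * ρ U))) →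
    Measurable E → (∀ V, 0 ≤ E V) → (∀ V, E V ≤ CE) →
    Measurable ((Family1100.mk n chiK4 comp).bareProdOp E) ∧
      (∀ V, 0 ≤ (Family1100.mk n chiK4 comp).bareProdOp E V) ∧
      ∃ B : ℝ, ∀ V, (Family1100.mk n chiK4 comp).bareProdOp E V ≤ B := by
  intro n
  induction n with
  | zero =>
    intro comp u chiK4 E CE _ _ hEm hE0 hEC
    exact ⟨hEm, hE0, CE, hEC⟩
  | succ n IH =>
    intro comp u chiK4 E CE hw hloc hEm hE0 hEC
    obtain ⟨hm, h0, B, hB⟩ := IH (fun i => comp i.succ) (fun i => u i.succ) chiK4 E CE (fun i => hw i.succ)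
      (fun i l => hloc i.succ l) hEm hE0 hEC
    rw [bareProdOp_mk_succ]
    obtain ⟨hm', h0', hB'⟩ := bareOp_regular (comp 0) (u 0) (hw 0) (hloc 0) hm h0 hB
    exact ⟨hm', h0', _, hB'⟩

end Product

/-! ## Part 3. (1.102) for the curly bracket, for 𝐑′, and `Normalization1102` — PROVED in the fibre model -/

section Normalization

variable {Cn c Cu : ℝ}

/-- **The inserts of an `n`-component family integrate to one under `∫dV_k`, against any admissible outer factor.**
For `n` components in the fibre model (hypotheses as in `prodOp_regular`, plus: `χ_{k,Λ_i}` and the old weights `u_i`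
of an EARLIER component do not depend on the fresh variables `V_k⌈_{Λ_{i′}}` of a LATER one — *"localized in X_i"*,
p. 201) and an outer factor `g` (measurable, nonnegative, bounded, independent of every `V_k⌈_{Λ_i}`):
`∫dV_k g·Π_{i}[bracket_i](E) = ∫dV_k g·Π_{i}[bare bracket_i](E)`.  Proof = the printed mechanism, one component at a
time along the composition: the first insert quotient integrates to one against the rest (`B15.BasicStep.
integral_normTerm_eq`, the rest being independent of `V_k⌈_{Λ_1}` because the old operation has integrated those
variables, p. 194), the old fibre integration is undone under `∫dV_k` (`integral_mul_fibreIntegral`), and the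
induction hypothesis is applied with the outer factor `g·χ_{k,Λ_1}·u_1`. [cite: Balaban1989LargeFieldI, (1.102) p.201] -/
theorem integral_mul_prodOp_eq (hc : 0 < c) : ∀ (n : ℕ) (comp : Fin n → Component1100 P k G)
    (u : (i : Fin n) → (comp i).Loc → Density P k G) (chiK4 E g : Density P k G) (CE Cg : ℝ),
    (∀ i, 0 ≤ (comp i).weight) →
    (∀ i l, Measurable ((comp i).chiKΛ l) ∧ (∀ V, 0 ≤ (comp i).chiKΛ l V ∧ (comp i).chiKΛ l V ≤ 1) ∧
      Measurable ((comp i).ins l).num ∧ (∀ V, 0 ≤ ((comp i).ins l).num V ∧ ((comp i).ins l).num V ≤ Cn) ∧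
      (∀ V, c ≤ ((comp i).ins l).den V) ∧ Measurable (u i l) ∧ (∀ V, 0 ≤ u i l V ∧ u i l V ≤ Cu) ∧
      (∀ ρ, (comp i).oldOp l ρ = fibreIntegral ((comp i).ins l).lam (fun U => u i l U * ρ U)) ∧
      (∀ (V : GaugeField P k G) (y : ↥((comp i).ins l).lam → G),
        (comp i).chiKΛ l (updateFinset V ((comp i).ins l).lam y) = (comp i).chiKΛ l V)) →
    (∀ i i' : Fin n, i < i' → ∀ l l' (V : GaugeField P k G) (y : ↥((comp i').ins l').lam → G),
      (comp i).chiKΛ l (updateFinset V ((comp i').ins l').lam y) = (comp i).chiKΛ l V ∧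
      u i l (updateFinset V ((comp i').ins l').lam y) = u i l V) →
    Measurable E → (∀ V, 0 ≤ E V) → (∀ V, E V ≤ CE) →
    Measurable g → (∀ V, 0 ≤ g V) → (∀ V, g V ≤ Cg) →
    (∀ i l (V : GaugeField P k G) (y : ↥((comp i).ins l).lam → G), g (updateFinset V ((comp i).ins l).lam y) = g V) →
    ∫ V, g V * (Family1100.mk n chiK4 comp).prodOp E V ∂(fieldMeasure P k G)
      = ∫ V, g V * (Family1100.mk n chiK4 comp).bareProdOp E V ∂(fieldMeasure P k G) := by
  intro n
  induction n with
  | zero =>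
    intro comp u chiK4 E g CE Cg _ _ _ _ _ _ _ _ _ _
    rfl
  | succ n IH =>
    intro comp u chiK4 E g CE Cg hw hloc hlater hEm hE0 hEC hgm hg0 hgC hgind
    have hCg0 : 0 ≤ Cg := (hg0 1).trans (hgC 1)
    -- the tail family `Π_{i ≥ 2}` and its two products
    have hw' : ∀ i : Fin n, 0 ≤ (comp i.succ).weight := fun i => hw i.succ
    have hlater' : ∀ i i' : Fin n, i < i' → ∀ l l' (V : GaugeField P k G)
        (y : ↥((comp i'.succ).ins l').lam → G),
        (comp i.succ).chiKΛ l (updateFinset V ((comp i'.succ).ins l').lam y) = (comp i.succ).chiKΛ l V ∧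
        u i.succ l (updateFinset V ((comp i'.succ).ins l').lam y) = u i.succ l V :=
      fun i i' h => hlater i.succ i'.succ (Fin.succ_lt_succ_iff.mpr h)
    obtain ⟨hσm, hσ0, B, hσB⟩ := prodOp_regular hc n (fun i => comp i.succ) (fun i => u i.succ) chiK4 E CE hw'
      (fun i l => hloc i.succ l) hEm hE0 hEC
    obtain ⟨hτm, hτ0, B', hτB⟩ := bareProdOp_regular (Cu := Cu) n (fun i => comp i.succ) (fun i => u i.succ)
      chiK4 E CE hw' (fun i l => ⟨(hloc i.succ l).1, (hloc i.succ l).2.1, (hloc i.succ l).2.2.2.2.2.1,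
        (hloc i.succ l).2.2.2.2.2.2.1, (hloc i.succ l).2.2.2.2.2.2.2.1⟩) hEm hE0 hEC
    have hB0 : 0 ≤ B := (hσ0 1).trans (hσB 1)
    have hB'0 : 0 ≤ B' := (hτ0 1).trans (hτB 1)
    rw [prodOp_mk_succ, bareProdOp_mk_succ]
    set σ := (Family1100.mk n chiK4 (fun i => comp i.succ)).prodOp E with hσ
    set τ := (Family1100.mk n chiK4 (fun i => comp i.succ)).bareProdOp E with hτ
    simp only [Function.comp_apply]
    -- notation for the first component
    set C := comp 0 with hC
    -- per localized datum `l`: the chain (i)–(iv) of the docstring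
    have hterm : ∀ l : C.Loc,
        ∫ V, g V * (C.chiKΛ l V * (C.ins l).ratio V * C.oldOp l σ V) ∂(fieldMeasure P k G)
          = ∫ V, g V * (C.chiKΛ l V * C.oldOp l τ V) ∂(fieldMeasure P k G) := by
      intro l
      obtain ⟨hχm, hχb, hnm, hnb, hden, hum, hub, hold, hχself⟩ := hloc 0 l
      have hCu0 : 0 ≤ Cu := (hub 1).1.trans (hub 1).2
      set I := C.ins l with hI
      -- the old operation in fibre form, applied to `σ` and to `τ`
      have hOσ : C.oldOp l σ = fibreIntegral I.lam (fun U => u 0 l U * σ U) := hold σ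
      have hOτ : C.oldOp l τ = fibreIntegral I.lam (fun U => u 0 l U * τ U) := hold τ
      -- the outer factor for the first component, `h = g·χ_{k,Λ_l}` (independent of `V_k⌈_{Λ_l}`)
      have hhm : Measurable (fun V => g V * C.chiKΛ l V) := hgm.mul hχm
      have hh0 : ∀ V, 0 ≤ g V * C.chiKΛ l V := fun V => mul_nonneg (hg0 V) (hχb V).1
      have hhC : ∀ V, g V * C.chiKΛ l V ≤ Cg := fun V =>
        (mul_le_mul (hgC V) (hχb V).2 (hχb V).1 hCg0).trans (by rw [mul_one])
      have hhind : ∀ (V : GaugeField P k G) (y : ↥I.lam → G),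
          g (updateFinset V I.lam y) * C.chiKΛ l (updateFinset V I.lam y) = g V * C.chiKΛ l V := by
        intro V y; rw [hgind 0 l V y, hχself V y]
      -- (i) the insert quotient integrates to one against `Gl = g·χ·oldOp_l σ`, independent of `V_k⌈_{Λ_l}`
      have hGm : Measurable (fun V => g V * C.chiKΛ l V * C.oldOp l σ V) := by
        rw [hOσ]; exact hhm.mul (measurable_fibreIntegral _ (hum.mul hσm))
      have hG0 : ∀ V, 0 ≤ g V * C.chiKΛ l V * C.oldOp l σ V := fun V => by
        rw [hOσ]; exact mul_nonneg (hh0 V) (fibreIntegral_nonneg _ _ V)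
      have huσC : ∀ U, u 0 l U * σ U ≤ Cu * B := fun U => mul_le_mul (hub U).2 (hσB U) (hσ0 U) hCu0
      have huτC : ∀ U, u 0 l U * τ U ≤ Cu * B' := fun U => mul_le_mul (hub U).2 (hτB U) (hτ0 U) hCu0
      have hGC : ∀ V, g V * C.chiKΛ l V * C.oldOp l σ V ≤ max Cn (Cg * (Cu * B)) := fun V => by
        rw [hOσ]
        refine le_trans ?_ (le_max_right _ _)
        exact mul_le_mul (hhC V) (fibreIntegral_le _ huσC (mul_nonneg hCu0 hB0) V) (fibreIntegral_nonneg _ _ V) hCg0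
      have hGind : ∀ (V : GaugeField P k G) (y : ↥I.lam → G),
          g (updateFinset V I.lam y) * C.chiKΛ l (updateFinset V I.lam y) * C.oldOp l σ (updateFinset V I.lam y)
            = g V * C.chiKΛ l V * C.oldOp l σ V := by
        intro V y; rw [hhind V y, hOσ, fibreIntegral_update_self]
      have step1 : ∫ V, g V * (C.chiKΛ l V * I.ratio V * C.oldOp l σ V) ∂(fieldMeasure P k G)
          = ∫ V, g V * C.chiKΛ l V * C.oldOp l σ V ∂(fieldMeasure P k G) := by
        have e : ∀ V, g V * (C.chiKΛ l V * I.ratio V * C.oldOp l σ V)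
            = normTerm I.lam I.num (fun U => g U * C.chiKΛ l U * C.oldOp l σ U) V := by
          intro V
          simp only [normTerm, Insert1100.ratio, Insert1100.den]
          rw [fibreIntegral_of_indep I.lam hGind hG0 V]
          ring
        rw [integral_congr_ae (Filter.Eventually.of_forall e)]
        exact integral_normTerm_eq I.lam hnm hGm (fun V => (hnb V).1) hG0
          (fun V => (hnb V).2.trans (le_max_left _ _)) hGC (fun V => (hc.trans_le (hden V)).ne')
      -- (ii) undo the old fibre integration under `∫dV_k`: `∫ g χ ∫⌈(u σ) = ∫ g χ u σ`
      have step2 : ∫ V, g V * C.chiKΛ l V * C.oldOp l σ V ∂(fieldMeasure P k G)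
          = ∫ V, (g V * C.chiKΛ l V * u 0 l V) * σ V ∂(fieldMeasure P k G) := by
        rw [hOσ]
        have e : ∀ V, (g V * C.chiKΛ l V) * (u 0 l V * σ V) = (g V * C.chiKΛ l V * u 0 l V) * σ V :=
          fun V => by ring
        calc ∫ V, g V * C.chiKΛ l V * fibreIntegral I.lam (fun U => u 0 l U * σ U) V ∂(fieldMeasure P k G)
            = ∫ V, (g V * C.chiKΛ l V) * (u 0 l V * σ V) ∂(fieldMeasure P k G) :=
              integral_mul_fibreIntegral I.lam (h := fun V => g V * C.chiKΛ l V) (f := fun U => u 0 l U * σ U)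
                hhm hh0 hhC hhind (hum.mul hσm) (fun V => mul_nonneg (hub V).1 (hσ0 V)) huσC
          _ = ∫ V, (g V * C.chiKΛ l V * u 0 l V) * σ V ∂(fieldMeasure P k G) :=
              integral_congr_ae (Filter.Eventually.of_forall e)
      -- (iii) the induction hypothesis with the outer factor `g·χ_{k,Λ_l}·u_l`
      have step3 : ∫ V, (g V * C.chiKΛ l V * u 0 l V) * σ V ∂(fieldMeasure P k G)
          = ∫ V, (g V * C.chiKΛ l V * u 0 l V) * τ V ∂(fieldMeasure P k G) := by
        refine IH (fun i => comp i.succ) (fun i => u i.succ) chiK4 E (fun V => g V * C.chiKΛ l V * u 0 l V) CE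
          (Cg * Cu) hw' (fun i l => hloc i.succ l) hlater' hEm hE0 hEC (hhm.mul hum)
          (fun V => mul_nonneg (hh0 V) (hub V).1) (fun V => mul_le_mul (hhC V) (hub V).2 (hub V).1 hCg0) ?_
        intro i l' V y
        have h1 := hlater 0 i.succ (Fin.succ_pos i) l l' V y
        rw [hgind i.succ l' V y, h1.1, h1.2]
      -- (iv) redo the old fibre integration on the insert-free side
      have step4 : ∫ V, (g V * C.chiKΛ l V * u 0 l V) * τ V ∂(fieldMeasure P k G)
          = ∫ V, g V * (C.chiKΛ l V * C.oldOp l τ V) ∂(fieldMeasure P k G) := by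
        rw [hOτ]
        have e1 : ∀ V, (g V * C.chiKΛ l V * u 0 l V) * τ V = (g V * C.chiKΛ l V) * (u 0 l V * τ V) :=
          fun V => by ring
        have e2 : ∀ V, (g V * C.chiKΛ l V) * fibreIntegral I.lam (fun U => u 0 l U * τ U) V
            = g V * (C.chiKΛ l V * fibreIntegral I.lam (fun U => u 0 l U * τ U) V) := fun V => by ring
        calc ∫ V, (g V * C.chiKΛ l V * u 0 l V) * τ V ∂(fieldMeasure P k G)
            = ∫ V, (g V * C.chiKΛ l V) * (u 0 l V * τ V) ∂(fieldMeasure P k G) :=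
              integral_congr_ae (Filter.Eventually.of_forall e1)
          _ = ∫ V, (g V * C.chiKΛ l V) * fibreIntegral I.lam (fun U => u 0 l U * τ U) V ∂(fieldMeasure P k G) :=
              (integral_mul_fibreIntegral I.lam (h := fun V => g V * C.chiKΛ l V) (f := fun U => u 0 l U * τ U)
                hhm hh0 hhC hhind (hum.mul hτm) (fun V => mul_nonneg (hub V).1 (hτ0 V)) huτC).symm
          _ = ∫ V, g V * (C.chiKΛ l V * fibreIntegral I.lam (fun U => u 0 l U * τ U) V) ∂(fieldMeasure P k G) :=
              integral_congr_ae (Filter.Eventually.of_forall e2)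
      rw [step1, step2, step3, step4]
    -- summing the brackets: both sides are `weight · Σ_l (term_l)`, integrable termwise
    have hr_m : ∀ l, Measurable (C.ins l).ratio := fun l =>
      (hloc 0 l).2.2.1.div (measurable_fibreIntegral _ (hloc 0 l).2.2.1)
    have hr0 : ∀ l V, 0 ≤ (C.ins l).ratio V := fun l V =>
      div_nonneg ((hloc 0 l).2.2.2.1 V).1 (hc.le.trans ((hloc 0 l).2.2.2.2.1 V))
    have hrB : ∀ l V, (C.ins l).ratio V ≤ Cn / c := fun l V =>
      div_le_div₀ ((((hloc 0 l).2.2.2.1 V).1.trans ((hloc 0 l).2.2.2.1 V).2)) ((hloc 0 l).2.2.2.1 V).2 hc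
        ((hloc 0 l).2.2.2.2.1 V)
    have hO : ∀ l (ρ : Density P k G), Measurable ρ → (∀ V, 0 ≤ ρ V) → ∀ Bρ, (∀ V, ρ V ≤ Bρ) →
        Measurable (C.oldOp l ρ) ∧ (∀ V, 0 ≤ C.oldOp l ρ V) ∧ (∀ V, C.oldOp l ρ V ≤ Cu * Bρ) := by
      intro l ρ hρm hρ0 Bρ hρB
      have hub := (hloc 0 l).2.2.2.2.2.2.1
      have hCu0 : 0 ≤ Cu := (hub 1).1.trans (hub 1).2
      rw [(hloc 0 l).2.2.2.2.2.2.2.1 ρ]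
      exact ⟨measurable_fibreIntegral _ ((hloc 0 l).2.2.2.2.2.1.mul hρm), fun V => fibreIntegral_nonneg _ _ V,
        fun V => fibreIntegral_le _ (fun U => mul_le_mul (hub U).2 (hρB U) (hρ0 U) hCu0)
          (mul_nonneg hCu0 ((hρ0 1).trans (hρB 1))) V⟩
    have hintL : ∀ l, Integrable (fun V => g V * (C.chiKΛ l V * (C.ins l).ratio V * C.oldOp l σ V))
        (fieldMeasure P k G) := by
      intro l
      obtain ⟨hOm, hO0, hOB⟩ := hO l σ hσm hσ0 B hσB
      refine integrable_of_bdd (hgm.mul ((((hloc 0 l).1.mul (hr_m l)).mul hOm)))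
        (fun V => mul_nonneg (hg0 V) (mul_nonneg (mul_nonneg ((hloc 0 l).2.1 V).1 (hr0 l V)) (hO0 V)))
        (C := Cg * (1 * (Cn / c) * (Cu * B))) (fun V => ?_)
      have hCn0 : 0 ≤ Cn / c := div_nonneg ((((hloc 0 l).2.2.2.1 V).1.trans ((hloc 0 l).2.2.2.1 V).2)) hc.le
      exact mul_le_mul (hgC V) (mul_le_mul (mul_le_mul ((hloc 0 l).2.1 V).2 (hrB l V) (hr0 l V) zero_le_one)
        (hOB V) (hO0 V) (mul_nonneg zero_le_one hCn0)) (mul_nonneg (mul_nonneg ((hloc 0 l).2.1 V).1 (hr0 l V))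
        (hO0 V)) hCg0
    have hintR : ∀ l, Integrable (fun V => g V * (C.chiKΛ l V * C.oldOp l τ V)) (fieldMeasure P k G) := by
      intro l
      obtain ⟨hOm, hO0, hOB⟩ := hO l τ hτm hτ0 B' hτB
      refine integrable_of_bdd (hgm.mul (((hloc 0 l).1.mul hOm)))
        (fun V => mul_nonneg (hg0 V) (mul_nonneg ((hloc 0 l).2.1 V).1 (hO0 V)))
        (C := Cg * (1 * (Cu * B'))) (fun V => ?_)
      exact mul_le_mul (hgC V) (mul_le_mul ((hloc 0 l).2.1 V).2 (hOB V) (hO0 V) zero_le_one)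
        (mul_nonneg ((hloc 0 l).2.1 V).1 (hO0 V)) hCg0
    have eL : ∀ V, g V * C.op σ V
        = ∑ l, C.weight * (g V * (C.chiKΛ l V * (C.ins l).ratio V * C.oldOp l σ V)) := by
      intro V
      show g V * (C.weight * ∑ l, C.chiKΛ l V * (C.ins l).ratio V * C.oldOp l σ V) = _
      rw [Finset.mul_sum, Finset.mul_sum]
      exact Finset.sum_congr rfl (fun l _ => by ring)
    have eR : ∀ V, g V * C.bareOp τ V = ∑ l, C.weight * (g V * (C.chiKΛ l V * C.oldOp l τ V)) := by
      intro V
      show g V * (C.weight * ∑ l, C.chiKΛ l V * C.oldOp l τ V) = _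
      rw [Finset.mul_sum, Finset.mul_sum]
      exact Finset.sum_congr rfl (fun l _ => by ring)
    rw [integral_congr_ae (Filter.Eventually.of_forall eL), integral_congr_ae (Filter.Eventually.of_forall eR),
      integral_finsetSum _ (fun l _ => (hintL l).const_mul C.weight),
      integral_finsetSum _ (fun l _ => (hintR l).const_mul C.weight)]
    refine Finset.sum_congr rfl (fun l _ => ?_)
    rw [integral_const_mul, integral_const_mul, hterm l]

end Normalization

/-! ## Part 4. The curly bracket, 𝐑′ (1.100), and (1.102) for the OBJECT (`B15Sect1Statements.Normalization1102`) -/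

section RPrime

variable {Cn c Cu : ℝ}

/-- Regularity of the curly bracket `{Σ_{n≥0}Σ_{{X_i}} χ_k(Ω_k^{∼4}) Π_i[ … ] exp A″_k}` of (1.100) in the fibre model
(`χ_k(Ω_k^{∼4}) ∈ [0,1]` measurable; `exp A″_k` measurable, nonnegative, bounded). [cite: Balaban1989LargeFieldI, (1.100) p.201] -/
theorem curly_regular (hc : 0 < c) (D : RPrimeData P k G) (z : D.ZK)
    (u : (f : D.Fam z) → (i : Fin (D.fam z f).n) → ((D.fam z f).comp i).Loc → Density P k G) {CE : ℝ}
    (hw : ∀ f i, 0 ≤ ((D.fam z f).comp i).weight)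
    (hloc : ∀ f i l, Measurable (((D.fam z f).comp i).chiKΛ l) ∧
      (∀ V, 0 ≤ ((D.fam z f).comp i).chiKΛ l V ∧ ((D.fam z f).comp i).chiKΛ l V ≤ 1) ∧
      Measurable (((D.fam z f).comp i).ins l).num ∧
      (∀ V, 0 ≤ (((D.fam z f).comp i).ins l).num V ∧ (((D.fam z f).comp i).ins l).num V ≤ Cn) ∧
      (∀ V, c ≤ (((D.fam z f).comp i).ins l).den V) ∧ Measurable (u f i l) ∧ (∀ V, 0 ≤ u f i l V ∧ u f i l V ≤ Cu) ∧
      (∀ ρ, ((D.fam z f).comp i).oldOp l ρ = fibreIntegral (((D.fam z f).comp i).ins l).lam (fun U => u f i l U * ρ U)) ∧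
      (∀ (V : GaugeField P k G) (y : ↥(((D.fam z f).comp i).ins l).lam → G),
        ((D.fam z f).comp i).chiKΛ l (updateFinset V (((D.fam z f).comp i).ins l).lam y) = ((D.fam z f).comp i).chiKΛ l V))
    (hK4m : ∀ f, Measurable (D.fam z f).chiK4) (hK4b : ∀ f V, 0 ≤ (D.fam z f).chiK4 V ∧ (D.fam z f).chiK4 V ≤ 1)
    (hEm : Measurable (D.expA z)) (hE0 : ∀ V, 0 ≤ D.expA z V) (hEC : ∀ V, D.expA z V ≤ CE) :
    Measurable (D.curly z) ∧ (∀ V, 0 ≤ D.curly z V) ∧ ∃ Bc : ℝ, ∀ V, D.curly z V ≤ Bc := by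
  have hf : ∀ f, Measurable ((D.fam z f).prodOp (D.expA z)) ∧ (∀ V, 0 ≤ (D.fam z f).prodOp (D.expA z) V) ∧
      ∃ B : ℝ, ∀ V, (D.fam z f).prodOp (D.expA z) V ≤ B := fun f =>
    prodOp_regular hc (D.fam z f).n (D.fam z f).comp (u f) (D.fam z f).chiK4 (D.expA z) CE (hw f) (hloc f)
      hEm hE0 hEC
  choose hm h0 Bf hB using hf
  refine ⟨?_, ?_, ∑ f, Bf f, ?_⟩
  · show Measurable (fun V => ∑ f, (D.fam z f).chiK4 V * (D.fam z f).prodOp (D.expA z) V)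
    exact Finset.measurable_sum _ (fun f _ => (hK4m f).mul (hm f))
  · intro V
    show 0 ≤ ∑ f, (D.fam z f).chiK4 V * (D.fam z f).prodOp (D.expA z) V
    exact Finset.sum_nonneg (fun f _ => mul_nonneg (hK4b f V).1 (h0 f V))
  · intro V
    show ∑ f, (D.fam z f).chiK4 V * (D.fam z f).prodOp (D.expA z) V ≤ ∑ f, Bf f
    exact Finset.sum_le_sum (fun f _ =>
      (mul_le_mul (hK4b f V).2 (hB f V) (h0 f V) zero_le_one).trans (by rw [one_mul]))

omit [DecidableEq (PBond P k)] in
/-- Regularity of the insert-free curly bracket ((1.99) side). [cite: Balaban1989LargeFieldI, (1.99) p.201] -/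
theorem bareCurly_regular [DecidableEq (PBond P k)] (D : RPrimeData P k G) (z : D.ZK)
    (u : (f : D.Fam z) → (i : Fin (D.fam z f).n) → ((D.fam z f).comp i).Loc → Density P k G) {CE : ℝ}
    (hw : ∀ f i, 0 ≤ ((D.fam z f).comp i).weight)
    (hloc : ∀ f i l, Measurable (((D.fam z f).comp i).chiKΛ l) ∧
      (∀ V, 0 ≤ ((D.fam z f).comp i).chiKΛ l V ∧ ((D.fam z f).comp i).chiKΛ l V ≤ 1) ∧
      Measurable (u f i l) ∧ (∀ V, 0 ≤ u f i l V ∧ u f i l V ≤ Cu) ∧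
      (∀ ρ, ((D.fam z f).comp i).oldOp l ρ = fibreIntegral (((D.fam z f).comp i).ins l).lam (fun U => u f i l U * ρ U)))
    (hK4m : ∀ f, Measurable (D.fam z f).chiK4) (hK4b : ∀ f V, 0 ≤ (D.fam z f).chiK4 V ∧ (D.fam z f).chiK4 V ≤ 1)
    (hEm : Measurable (D.expA z)) (hE0 : ∀ V, 0 ≤ D.expA z V) (hEC : ∀ V, D.expA z V ≤ CE) :
    Measurable (D.bareCurly z) ∧ (∀ V, 0 ≤ D.bareCurly z V) ∧ ∃ Bc : ℝ, ∀ V, D.bareCurly z V ≤ Bc := by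
  have hf : ∀ f, Measurable ((D.fam z f).bareProdOp (D.expA z)) ∧
      (∀ V, 0 ≤ (D.fam z f).bareProdOp (D.expA z) V) ∧
      ∃ B : ℝ, ∀ V, (D.fam z f).bareProdOp (D.expA z) V ≤ B := fun f =>
    bareProdOp_regular (Cu := Cu) (D.fam z f).n (D.fam z f).comp (u f) (D.fam z f).chiK4 (D.expA z) CE (hw f)
      (hloc f) hEm hE0 hEC
  choose hm h0 Bf hB using hf
  refine ⟨?_, ?_, ∑ f, Bf f, ?_⟩
  · show Measurable (fun V => ∑ f, (D.fam z f).chiK4 V * (D.fam z f).bareProdOp (D.expA z) V)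
    exact Finset.measurable_sum _ (fun f _ => (hK4m f).mul (hm f))
  · intro V
    show 0 ≤ ∑ f, (D.fam z f).chiK4 V * (D.fam z f).bareProdOp (D.expA z) V
    exact Finset.sum_nonneg (fun f _ => mul_nonneg (hK4b f V).1 (h0 f V))
  · intro V
    show ∑ f, (D.fam z f).chiK4 V * (D.fam z f).bareProdOp (D.expA z) V ≤ ∑ f, Bf f
    exact Finset.sum_le_sum (fun f _ =>
      (mul_le_mul (hK4b f V).2 (hB f V) (h0 f V) zero_le_one).trans (by rw [one_mul]))

/-- **The inserts of the whole curly bracket of (1.100) integrate to one** against any admissible outer factor `w`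
(measurable, nonnegative, bounded, independent of the fresh variables of every component of every family of `Z_k`):
`∫dV_k w·{…with inserts…} = ∫dV_k w·{…without…}`, in the fibre model (hypotheses of `integral_mul_prodOp_eq` for
every family, `χ_k(Ω_k^{∼4})` measurable in `[0,1]` and independent of the fresh variables of its family).
[cite: Balaban1989LargeFieldI, (1.102) p.201] -/
theorem integral_mul_curly_eq (hc : 0 < c) (D : RPrimeData P k G) (z : D.ZK)
    (u : (f : D.Fam z) → (i : Fin (D.fam z f).n) → ((D.fam z f).comp i).Loc → Density P k G) {CE Cw : ℝ}
    (hw : ∀ f i, 0 ≤ ((D.fam z f).comp i).weight)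
    (hloc : ∀ f i l, Measurable (((D.fam z f).comp i).chiKΛ l) ∧
      (∀ V, 0 ≤ ((D.fam z f).comp i).chiKΛ l V ∧ ((D.fam z f).comp i).chiKΛ l V ≤ 1) ∧
      Measurable (((D.fam z f).comp i).ins l).num ∧
      (∀ V, 0 ≤ (((D.fam z f).comp i).ins l).num V ∧ (((D.fam z f).comp i).ins l).num V ≤ Cn) ∧
      (∀ V, c ≤ (((D.fam z f).comp i).ins l).den V) ∧ Measurable (u f i l) ∧ (∀ V, 0 ≤ u f i l V ∧ u f i l V ≤ Cu) ∧
      (∀ ρ, ((D.fam z f).comp i).oldOp l ρ = fibreIntegral (((D.fam z f).comp i).ins l).lam (fun U => u f i l U * ρ U)) ∧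
      (∀ (V : GaugeField P k G) (y : ↥(((D.fam z f).comp i).ins l).lam → G),
        ((D.fam z f).comp i).chiKΛ l (updateFinset V (((D.fam z f).comp i).ins l).lam y) = ((D.fam z f).comp i).chiKΛ l V))
    (hlater : ∀ f (i i' : Fin (D.fam z f).n), i < i' → ∀ l l' (V : GaugeField P k G)
      (y : ↥(((D.fam z f).comp i').ins l').lam → G),
      ((D.fam z f).comp i).chiKΛ l (updateFinset V (((D.fam z f).comp i').ins l').lam y) = ((D.fam z f).comp i).chiKΛ l V ∧
      u f i l (updateFinset V (((D.fam z f).comp i').ins l').lam y) = u f i l V)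
    (hK4m : ∀ f, Measurable (D.fam z f).chiK4) (hK4b : ∀ f V, 0 ≤ (D.fam z f).chiK4 V ∧ (D.fam z f).chiK4 V ≤ 1)
    (hK4ind : ∀ f i l (V : GaugeField P k G) (y : ↥(((D.fam z f).comp i).ins l).lam → G),
      (D.fam z f).chiK4 (updateFinset V (((D.fam z f).comp i).ins l).lam y) = (D.fam z f).chiK4 V)
    (hEm : Measurable (D.expA z)) (hE0 : ∀ V, 0 ≤ D.expA z V) (hEC : ∀ V, D.expA z V ≤ CE)
    {w : Density P k G} (hwm : Measurable w) (hw0 : ∀ V, 0 ≤ w V) (hwC : ∀ V, w V ≤ Cw)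
    (hwind : ∀ f i l (V : GaugeField P k G) (y : ↥(((D.fam z f).comp i).ins l).lam → G),
      w (updateFinset V (((D.fam z f).comp i).ins l).lam y) = w V) :
    ∫ V, w V * D.curly z V ∂(fieldMeasure P k G) = ∫ V, w V * D.bareCurly z V ∂(fieldMeasure P k G) := by
  have hCw0 : 0 ≤ Cw := (hw0 1).trans (hwC 1)
  have hP : ∀ f, Measurable ((D.fam z f).prodOp (D.expA z)) ∧ (∀ V, 0 ≤ (D.fam z f).prodOp (D.expA z) V) ∧
      ∃ B : ℝ, ∀ V, (D.fam z f).prodOp (D.expA z) V ≤ B := fun f =>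
    prodOp_regular hc (D.fam z f).n (D.fam z f).comp (u f) (D.fam z f).chiK4 (D.expA z) CE (hw f) (hloc f)
      hEm hE0 hEC
  have hQ : ∀ f, Measurable ((D.fam z f).bareProdOp (D.expA z)) ∧
      (∀ V, 0 ≤ (D.fam z f).bareProdOp (D.expA z) V) ∧
      ∃ B : ℝ, ∀ V, (D.fam z f).bareProdOp (D.expA z) V ≤ B := fun f =>
    bareProdOp_regular (Cu := Cu) (D.fam z f).n (D.fam z f).comp (u f) (D.fam z f).chiK4 (D.expA z) CE (hw f)
      (fun i l => ⟨(hloc f i l).1, (hloc f i l).2.1, (hloc f i l).2.2.2.2.2.1, (hloc f i l).2.2.2.2.2.2.1,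
        (hloc f i l).2.2.2.2.2.2.2.1⟩) hEm hE0 hEC
  choose hPm hP0 BP hPB using hP
  choose hQm hQ0 BQ hQB using hQ
  have hintL : ∀ f, Integrable (fun V => w V * ((D.fam z f).chiK4 V * (D.fam z f).prodOp (D.expA z) V))
      (fieldMeasure P k G) := fun f =>
    integrable_of_bdd (hwm.mul ((hK4m f).mul (hPm f)))
      (fun V => mul_nonneg (hw0 V) (mul_nonneg (hK4b f V).1 (hP0 f V))) (C := Cw * (1 * BP f))
      (fun V => mul_le_mul (hwC V) (mul_le_mul (hK4b f V).2 (hPB f V) (hP0 f V) zero_le_one)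
        (mul_nonneg (hK4b f V).1 (hP0 f V)) hCw0)
  have hintR : ∀ f, Integrable (fun V => w V * ((D.fam z f).chiK4 V * (D.fam z f).bareProdOp (D.expA z) V))
      (fieldMeasure P k G) := fun f =>
    integrable_of_bdd (hwm.mul ((hK4m f).mul (hQm f)))
      (fun V => mul_nonneg (hw0 V) (mul_nonneg (hK4b f V).1 (hQ0 f V))) (C := Cw * (1 * BQ f))
      (fun V => mul_le_mul (hwC V) (mul_le_mul (hK4b f V).2 (hQB f V) (hQ0 f V) zero_le_one)
        (mul_nonneg (hK4b f V).1 (hQ0 f V)) hCw0)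
  have eL : ∀ V, w V * D.curly z V = ∑ f, w V * ((D.fam z f).chiK4 V * (D.fam z f).prodOp (D.expA z) V) :=
    fun V => by show w V * ∑ f, _ = _; rw [Finset.mul_sum]
  have eR : ∀ V, w V * D.bareCurly z V
      = ∑ f, w V * ((D.fam z f).chiK4 V * (D.fam z f).bareProdOp (D.expA z) V) :=
    fun V => by show w V * ∑ f, _ = _; rw [Finset.mul_sum]
  rw [integral_congr_ae (Filter.Eventually.of_forall eL), integral_congr_ae (Filter.Eventually.of_forall eR),
    integral_finsetSum _ (fun f _ => hintL f), integral_finsetSum _ (fun f _ => hintR f)]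
  refine Finset.sum_congr rfl (fun f _ => ?_)
  have e1 : ∀ V, w V * ((D.fam z f).chiK4 V * (D.fam z f).prodOp (D.expA z) V)
      = (w V * (D.fam z f).chiK4 V) * (D.fam z f).prodOp (D.expA z) V := fun V => by ring
  have e2 : ∀ V, (w V * (D.fam z f).chiK4 V) * (D.fam z f).bareProdOp (D.expA z) V
      = w V * ((D.fam z f).chiK4 V * (D.fam z f).bareProdOp (D.expA z) V) := fun V => by ring
  have key := integral_mul_prodOp_eq hc (D.fam z f).n (D.fam z f).comp (u f) (D.fam z f).chiK4 (D.expA z)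
    (fun V => w V * (D.fam z f).chiK4 V) CE Cw (hw f) (hloc f) (hlater f) hEm hE0 hEC (hwm.mul (hK4m f))
    (fun V => mul_nonneg (hw0 V) (hK4b f V).1)
    (fun V => (mul_le_mul (hwC V) (hK4b f V).2 (hK4b f V).1 hCw0).trans (by rw [mul_one]))
    (fun i l V y => by rw [hwind f i l V y, hK4ind f i l V y])
  calc ∫ V, w V * ((D.fam z f).chiK4 V * (D.fam z f).prodOp (D.expA z) V) ∂(fieldMeasure P k G)
      = ∫ V, (w V * (D.fam z f).chiK4 V) * (D.fam z f).prodOp (D.expA z) V ∂(fieldMeasure P k G) :=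
        integral_congr_ae (Filter.Eventually.of_forall e1)
    _ = ∫ V, (w V * (D.fam z f).chiK4 V) * (D.fam z f).bareProdOp (D.expA z) V ∂(fieldMeasure P k G) := key
    _ = ∫ V, w V * ((D.fam z f).chiK4 V * (D.fam z f).bareProdOp (D.expA z) V) ∂(fieldMeasure P k G) :=
        integral_congr_ae (Filter.Eventually.of_forall e2)

/-- **∫dV_k (𝐑′ρ_k) = ∫dV_k (1.99) — the insert quotients of 𝐑′ (1.100) integrate to one — PROVED in the fibre model**:
every family of every admissible `Z_k` as in `integral_mul_curly_eq`, and the operations `𝕋″_k(Z_k)` in fibre form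
`𝕋″ ρ = ∫dV⌈_{B}(w·ρ)` (p. 200: *"the integral operations have many forms, varying from the old 𝕋-operations to the
integrals as in (1.76)"*; any domains `B`, bounded nonnegative measurable weights `w` independent of the fresh
variables of the components — p. 201: the `Z_k∖Z` operations are separated from the components `X_1,…,X_n`).
[cite: Balaban1989LargeFieldI, (1.102) p.201] -/
theorem integral_rPrime1100_eq_bare199 (hc : 0 < c) (D : RPrimeData P k G)
    (u : (z : D.ZK) → (f : D.Fam z) → (i : Fin (D.fam z f).n) → ((D.fam z f).comp i).Loc → Density P k G)
    (B : (z : D.ZK) → D.TT z → Finset (PBond P k)) (w : (z : D.ZK) → D.TT z → Density P k G) {CE Cw : ℝ}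
    (hw : ∀ z f i, 0 ≤ ((D.fam z f).comp i).weight)
    (hloc : ∀ z f i l, Measurable (((D.fam z f).comp i).chiKΛ l) ∧
      (∀ V, 0 ≤ ((D.fam z f).comp i).chiKΛ l V ∧ ((D.fam z f).comp i).chiKΛ l V ≤ 1) ∧
      Measurable (((D.fam z f).comp i).ins l).num ∧
      (∀ V, 0 ≤ (((D.fam z f).comp i).ins l).num V ∧ (((D.fam z f).comp i).ins l).num V ≤ Cn) ∧
      (∀ V, c ≤ (((D.fam z f).comp i).ins l).den V) ∧ Measurable (u z f i l) ∧
      (∀ V, 0 ≤ u z f i l V ∧ u z f i l V ≤ Cu) ∧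
      (∀ ρ, ((D.fam z f).comp i).oldOp l ρ
        = fibreIntegral (((D.fam z f).comp i).ins l).lam (fun U => u z f i l U * ρ U)) ∧
      (∀ (V : GaugeField P k G) (y : ↥(((D.fam z f).comp i).ins l).lam → G),
        ((D.fam z f).comp i).chiKΛ l (updateFinset V (((D.fam z f).comp i).ins l).lam y) = ((D.fam z f).comp i).chiKΛ l V))
    (hlater : ∀ z f (i i' : Fin (D.fam z f).n), i < i' → ∀ l l' (V : GaugeField P k G)
      (y : ↥(((D.fam z f).comp i').ins l').lam → G),
      ((D.fam z f).comp i).chiKΛ l (updateFinset V (((D.fam z f).comp i').ins l').lam y) = ((D.fam z f).comp i).chiKΛ l V ∧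
      u z f i l (updateFinset V (((D.fam z f).comp i').ins l').lam y) = u z f i l V)
    (hK4m : ∀ z f, Measurable (D.fam z f).chiK4)
    (hK4b : ∀ z f V, 0 ≤ (D.fam z f).chiK4 V ∧ (D.fam z f).chiK4 V ≤ 1)
    (hK4ind : ∀ z f i l (V : GaugeField P k G) (y : ↥(((D.fam z f).comp i).ins l).lam → G),
      (D.fam z f).chiK4 (updateFinset V (((D.fam z f).comp i).ins l).lam y) = (D.fam z f).chiK4 V)
    (hEm : ∀ z, Measurable (D.expA z)) (hE0 : ∀ z V, 0 ≤ D.expA z V) (hEC : ∀ z V, D.expA z V ≤ CE)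
    (httOp : ∀ z t ρ, D.ttOp z t ρ = fibreIntegral (B z t) (fun U => w z t U * ρ U))
    (hwm : ∀ z t, Measurable (w z t)) (hwb : ∀ z t V, 0 ≤ w z t V ∧ w z t V ≤ Cw)
    (hwind : ∀ z t f i l (V : GaugeField P k G) (y : ↥(((D.fam z f).comp i).ins l).lam → G),
      w z t (updateFinset V (((D.fam z f).comp i).ins l).lam y) = w z t V) :
    ∫ V, rPrime1100 D V ∂(fieldMeasure P k G) = ∫ V, bare199 D V ∂(fieldMeasure P k G) := by
  -- regularity of the two curly brackets of every region
  have hcur := fun z => curly_regular hc D z (u z) (hw z) (hloc z) (hK4m z) (hK4b z) (hEm z) (hE0 z) (hEC z)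
  have hbcur := fun z => bareCurly_regular (Cu := Cu) D z (u z) (hw z)
    (fun f i l => ⟨(hloc z f i l).1, (hloc z f i l).2.1, (hloc z f i l).2.2.2.2.2.1, (hloc z f i l).2.2.2.2.2.2.1,
      (hloc z f i l).2.2.2.2.2.2.2.1⟩) (hK4m z) (hK4b z) (hEm z) (hE0 z) (hEC z)
  choose hcm hc0 Bc hcB using hcur
  choose hbm hb0 Bb hbB using hbcur
  -- one (z, t) term
  have hterm : ∀ z t, ∫ V, D.ttOp z t (D.curly z) V ∂(fieldMeasure P k G)
      = ∫ V, D.ttOp z t (D.bareCurly z) V ∂(fieldMeasure P k G) := by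
    intro z t
    have hCw0 : 0 ≤ Cw := (hwb z t 1).1.trans (hwb z t 1).2
    rw [httOp z t (D.curly z), httOp z t (D.bareCurly z),
      integral_fibreIntegral (B z t) (f := fun U => w z t U * D.curly z U) ((hwm z t).mul (hcm z))
        (fun V => mul_nonneg (hwb z t V).1 (hc0 z V))
        (C := Cw * Bc z) (fun V => mul_le_mul (hwb z t V).2 (hcB z V) (hc0 z V) hCw0),
      integral_fibreIntegral (B z t) (f := fun U => w z t U * D.bareCurly z U) ((hwm z t).mul (hbm z))
        (fun V => mul_nonneg (hwb z t V).1 (hb0 z V))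
        (C := Cw * Bb z) (fun V => mul_le_mul (hwb z t V).2 (hbB z V) (hb0 z V) hCw0)]
    exact integral_mul_curly_eq hc D z (u z) (hw z) (hloc z) (hlater z) (hK4m z) (hK4b z) (hK4ind z) (hEm z)
      (hE0 z) (hEC z) (hwm z t) (fun V => (hwb z t V).1) (fun V => (hwb z t V).2) (hwind z t)
  -- integrability of every term (bounded: `𝕋″` of a bounded density is bounded)
  have hint : ∀ z t (ρ : Density P k G), Measurable ρ → (∀ V, 0 ≤ ρ V) → ∀ Bρ, (∀ V, ρ V ≤ Bρ) →
      Integrable (D.ttOp z t ρ) (fieldMeasure P k G) := by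
    intro z t ρ hρm hρ0 Bρ hρB
    have hCw0 : 0 ≤ Cw := (hwb z t 1).1.trans (hwb z t 1).2
    rw [httOp z t ρ]
    exact integrable_of_bdd (measurable_fibreIntegral _ ((hwm z t).mul hρm)) (fun V => fibreIntegral_nonneg _ _ V)
      (C := Cw * Bρ) (fun V => fibreIntegral_le _ (fun U => mul_le_mul (hwb z t U).2 (hρB U) (hρ0 U) hCw0)
        (mul_nonneg hCw0 ((hρ0 1).trans (hρB 1))) V)
  show ∫ V, (∑ z, ∑ t, D.ttOp z t (D.curly z) V) ∂(fieldMeasure P k G)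
    = ∫ V, (∑ z, ∑ t, D.ttOp z t (D.bareCurly z) V) ∂(fieldMeasure P k G)
  rw [integral_finsetSum _ (fun z _ => integrable_finsetSum _
      (fun t _ => hint z t (D.curly z) (hcm z) (hc0 z) (Bc z) (hcB z))),
    integral_finsetSum _ (fun z _ => integrable_finsetSum _
      (fun t _ => hint z t (D.bareCurly z) (hbm z) (hb0 z) (Bb z) (hbB z)))]
  refine Finset.sum_congr rfl (fun z _ => ?_)
  rw [integral_finsetSum _ (fun t _ => hint z t (D.curly z) (hcm z) (hc0 z) (Bc z) (hcB z)),
    integral_finsetSum _ (fun t _ => hint z t (D.bareCurly z) (hbm z) (hb0 z) (Bb z) (hbB z))]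
  exact Finset.sum_congr rfl (fun t _ => hterm z t)

/-- **(1.102) for the OBJECT 𝐑′, PROVED in the fibre model**: with the equivalence (1.99) (`Equiv199`, equal integrals
of `ρ_k` and the un-inserted expression — the printed starting point) and the hypotheses of
`integral_rPrime1100_eq_bare199`, `Normalization1102 D ρ_k` holds, i.e. *"∫dV_k(ℝ′ρ_k)(V_k) = ∫dV_kρ_k(V_k)"*.  What is
NOT modelled (data supplied as hypotheses): the geometry making the `Λ_i` disjoint and the inserts/old operations
`X_i`-local ((1.6)–(1.23), (1.73)); positivity/analyticity of the effective densities ([II]); the lower bound `c`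
of the denominators. [cite: Balaban1989LargeFieldI, (1.102) p.201] -/
theorem normalization1102_of_fibreModel (hc : 0 < c) (D : RPrimeData P k G) (ρ : Density P k G)
    (h199 : Equiv199 D ρ)
    (u : (z : D.ZK) → (f : D.Fam z) → (i : Fin (D.fam z f).n) → ((D.fam z f).comp i).Loc → Density P k G)
    (B : (z : D.ZK) → D.TT z → Finset (PBond P k)) (w : (z : D.ZK) → D.TT z → Density P k G) {CE Cw : ℝ}
    (hw : ∀ z f i, 0 ≤ ((D.fam z f).comp i).weight)
    (hloc : ∀ z f i l, Measurable (((D.fam z f).comp i).chiKΛ l) ∧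
      (∀ V, 0 ≤ ((D.fam z f).comp i).chiKΛ l V ∧ ((D.fam z f).comp i).chiKΛ l V ≤ 1) ∧
      Measurable (((D.fam z f).comp i).ins l).num ∧
      (∀ V, 0 ≤ (((D.fam z f).comp i).ins l).num V ∧ (((D.fam z f).comp i).ins l).num V ≤ Cn) ∧
      (∀ V, c ≤ (((D.fam z f).comp i).ins l).den V) ∧ Measurable (u z f i l) ∧
      (∀ V, 0 ≤ u z f i l V ∧ u z f i l V ≤ Cu) ∧
      (∀ ρ', ((D.fam z f).comp i).oldOp l ρ'
        = fibreIntegral (((D.fam z f).comp i).ins l).lam (fun U => u z f i l U * ρ' U)) ∧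
      (∀ (V : GaugeField P k G) (y : ↥(((D.fam z f).comp i).ins l).lam → G),
        ((D.fam z f).comp i).chiKΛ l (updateFinset V (((D.fam z f).comp i).ins l).lam y) = ((D.fam z f).comp i).chiKΛ l V))
    (hlater : ∀ z f (i i' : Fin (D.fam z f).n), i < i' → ∀ l l' (V : GaugeField P k G)
      (y : ↥(((D.fam z f).comp i').ins l').lam → G),
      ((D.fam z f).comp i).chiKΛ l (updateFinset V (((D.fam z f).comp i').ins l').lam y) = ((D.fam z f).comp i).chiKΛ l V ∧
      u z f i l (updateFinset V (((D.fam z f).comp i').ins l').lam y) = u z f i l V)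
    (hK4m : ∀ z f, Measurable (D.fam z f).chiK4)
    (hK4b : ∀ z f V, 0 ≤ (D.fam z f).chiK4 V ∧ (D.fam z f).chiK4 V ≤ 1)
    (hK4ind : ∀ z f i l (V : GaugeField P k G) (y : ↥(((D.fam z f).comp i).ins l).lam → G),
      (D.fam z f).chiK4 (updateFinset V (((D.fam z f).comp i).ins l).lam y) = (D.fam z f).chiK4 V)
    (hEm : ∀ z, Measurable (D.expA z)) (hE0 : ∀ z V, 0 ≤ D.expA z V) (hEC : ∀ z V, D.expA z V ≤ CE)
    (httOp : ∀ z t ρ', D.ttOp z t ρ' = fibreIntegral (B z t) (fun U => w z t U * ρ' U))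
    (hwm : ∀ z t, Measurable (w z t)) (hwb : ∀ z t V, 0 ≤ w z t V ∧ w z t V ≤ Cw)
    (hwind : ∀ z t f i l (V : GaugeField P k G) (y : ↥(((D.fam z f).comp i).ins l).lam → G),
      w z t (updateFinset V (((D.fam z f).comp i).ins l).lam y) = w z t V) :
    Normalization1102 D ρ :=
  normalization1102_of_equiv199 D ρ h199
    (integral_rPrime1100_eq_bare199 hc D u B w hw hloc hlater hK4m hK4b hK4ind hEm hE0 hEC httOp hwm hwb hwind)

end RPrime

end Literature.MathematicalPhysics.QuantumFieldTheory.Balaban1983to89.B15Norm1102Object
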